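import Literature.Computability.AlgebraicComplexity.BDI20HwvEvaluationHardness
import HarnessLib

/-!
# Bläser–Dörfler–Ikenmeyer 2020/2021, Prop 7.5 (2): two-row tableau graphs of tree-width `Ω(√n)`
# — the statement and the grid tableaux (definitions)

Cell `val-lit`, seat x6 (gen 5). TYPES the second clause of BDI CCC 2021 Prop 7.5 = arXiv
Prop 20, which the §7 file `BDI20HwvEvaluationHardness.lean` left untyped ("Clause (2), a family
with treewidth `Ω(√n)`, is not typed"): "Additionally there is a family `(S'_n)` of semistandard
Young tableaux with two rows containing the numbers `{1, …, n}` exactly `4` times each and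
`G_{S'_n}` having treewidth `Ω(√n)`" — as the named fact `BDI2020_prop_7_5_lower`, DISCHARGED in
the theorem-only sibling `BDI20TableauTreewidthLowerBoundProofs.lean`
(`BDI2020_prop_7_5_lower_holds`, constant `C = 3` for all `n ≥ 4`). This file holds the statement
and the bodied definitions of the printed witnesses (no theorems):

THE PRINTED FAMILY (proof of Prop 20 (2), arXiv p0016.txt:L32-66). Take the `2k × 2k` grid;
"treat each diagonal `{(x,y) : x+y = j+1}` as layer `j` and label them by increasing `x`"
(`DiagLT`, `gridLabel`: the rank of `(x+y, x)` in lexicographic order); every grid edge joins a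
layer to the next and edges between consecutive layers do not cross, so listing the columns
`(u, v)` of the edges in this order gives a semistandard two-row tableau (`gridOutEdges`,
`gridEdges`, `gridTableau`); to make every label occur exactly `4` times the boundary edges
`{(1,2i-1),(1,2i)}`, `{(2k,2i-1),(2k,2i)}`, `{(2i-1,1),(2i,1)}`, `{(2i-1,2k),(2i,2k)}` are doubled
(`upMult`, `rightMult`; 0-indexed: on the sides `x ∈ {0, m-1}` the vertical edge from an even `y`,
on the sides `y ∈ {0, m-1}` the horizontal edge from an even `x`), and for `n` not of the form
`(2k)²` the tableau is padded by "four columns containing only a single cell with the number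
`i+1`" for each further label (`gridTableau m n`, labels `m², …, n-1`). The lower bound
`tw ≥ 2k - 1` comes from the grid (`Literature.Combinatorics.SimpleGraph.min_le_treewidth_grid`,
the crosses bramble; print: "this graph is known to have treewidth exactly `2k`").

HONEST FRAMING: typed ≠ endorsed; `VP ≠ VNP` is NOT proved and nothing here bears on it (LADDER-
VALIANT V4, row N4 constructivity side: the tree-width parameter governing BDI's evaluation
algorithm is genuinely `Θ(√n)` on two-row semistandard tableaux).

## References
* [BlaserDorflerIkenmeyer2020] arXiv:2002.11594 Prop 20 (2) and its proof (= CCC 2021 LIPIcs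
  200:29 Prop 7.5 (2)); held text `paper:arxiv-2002.11594` p0016.txt:L18-25 (statement),
  L32-66 (proof).
-/

noncomputable section

open scoped Classical

namespace Literature.Computability.AlgebraicComplexity

namespace BDI20Treewidth

/-! ### The diagonal labelling of the `m × m` grid -/

/-- Diagonal-lexicographic comparison of grid points: earlier diagonal `x + y`, then smaller `x`
("treat each diagonal `{(x,y) : x+y = j+1}` as layer `j` and label them by increasing `x`").
[cite: BlaserDorflerIkenmeyer2020, Prop 20 (2) (proof; arXiv p0016.txt:L65)] -/
def DiagLT (p q : ℕ × ℕ) : Prop :=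
  p.1 + p.2 < q.1 + q.2 ∨ (p.1 + p.2 = q.1 + q.2 ∧ p.1 < q.1)

/-- The vertex set `{0, …, m-1}²` of the `m × m` grid. [folklore] -/
def gridVerts (m : ℕ) : Finset (ℕ × ℕ) := Finset.range m ×ˢ Finset.range m

/-- The label of a grid point: its rank in the diagonal-lexicographic order (a bijection onto
`{0, …, m²-1}`, layers labelled consecutively, each by increasing `x`). [folklore] -/
def gridLabel (m : ℕ) (p : ℕ × ℕ) : ℕ := ((gridVerts m).filter fun q => DiagLT q p).card

/-- The grid points listed in diagonal-lexicographic order. [folklore] -/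
def gridVertList (m : ℕ) : List (ℕ × ℕ) :=
  (List.range (2 * m)).flatMap fun d =>
    ((List.range m).filter fun x => x ≤ d ∧ d - x < m).map fun x => (x, d - x)

/-- Multiplicity of the vertical edge `(x,y) — (x,y+1)`: doubled on the sides `x ∈ {0, m-1}` when
`y` is even (print, 1-indexed: the edges `{(1,2i-1),(1,2i)}`, `{(2k,2i-1),(2k,2i)}` are doubled).
[cite: BlaserDorflerIkenmeyer2020, Prop 20 (2) (proof; arXiv p0016.txt:L63)] -/
def upMult (m : ℕ) (p : ℕ × ℕ) : ℕ :=
  if (p.1 = 0 ∨ p.1 + 1 = m) ∧ p.2 % 2 = 0 then 2 else 1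

/-- Multiplicity of the horizontal edge `(x,y) — (x+1,y)`: doubled on the sides `y ∈ {0, m-1}`
when `x` is even (print: the edges `{(2i-1,1),(2i,1)}`, `{(2i-1,2k),(2i,2k)}` are doubled).
[cite: BlaserDorflerIkenmeyer2020, Prop 20 (2) (proof; arXiv p0016.txt:L63)] -/
def rightMult (m : ℕ) (p : ℕ × ℕ) : ℕ :=
  if (p.2 = 0 ∨ p.2 + 1 = m) ∧ p.1 % 2 = 0 then 2 else 1

/-- The edges leaving a grid point towards the next layer, with multiplicities, as ordered pairs
(tail, head), the head `(x, y+1)` before the head `(x+1, y)`. [folklore] -/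
def gridOutEdges (m : ℕ) (p : ℕ × ℕ) : List ((ℕ × ℕ) × (ℕ × ℕ)) :=
  (if p.2 + 1 < m then List.replicate (upMult m p) (p, (p.1, p.2 + 1)) else []) ++
    (if p.1 + 1 < m then List.replicate (rightMult m p) (p, (p.1 + 1, p.2)) else [])

/-- All edges of the doubled grid multigraph, in the order of their tails ("there is a unique
ordering on the set of edges from left to right"). [folklore] -/
def gridEdges (m : ℕ) : List ((ℕ × ℕ) × (ℕ × ℕ)) := (gridVertList m).flatMap (gridOutEdges m)

/-- **The tableau `S'_n`** on the labels `0, …, n-1` (`m² ≤ n`): one two-box column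
`(label u, label v)` per edge of the doubled `m × m` grid, in edge order, followed by four
single-box columns `(ℓ)` for each remaining label `ℓ = m², …, n-1` ("appending four columns
containing only a single cell with the number `i+1`").
[cite: BlaserDorflerIkenmeyer2020, Prop 20 (2) (proof; arXiv p0016.txt:L32-34, L46-49)] -/
def gridTableau (m n : ℕ) : List (List ℕ) :=
  (gridEdges m).map (fun e => [gridLabel m e.1, gridLabel m e.2]) ++
    (List.range (n - m * m)).flatMap fun i => List.replicate 4 [m * m + i]

end BDI20Treewidth

section Statement

open BDI2020 Literature.Combinatorics.SimpleGraph

-- FACT (discharged in `BDI20TableauTreewidthLowerBoundProofs.lean`)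
/-- **BDI Prop 7.5 (2) (arXiv Prop 20 (2)), the lower bound.** "Additionally there is a family
`(S'_n)` of semistandard Young tableaux with two rows containing the numbers `{1, …, n}` exactly
`4` times each and `G_{S'_n}` having treewidth `Ω(√n)`." Typed (the `Ω` made explicit): one
constant `C` such that for every `n ≥ 4` some semistandard Young tableau `S` of content `n × 4`
(Def 5.1: partition shape, every label `< n` occurring exactly four times) with columns of height
`≤ 2` has `⌊√n⌋ ≤ C · tw(G_S)`. (The `Ω` is asymptotic: for `n ≤ 3` a content-`n × 4` two-row
semistandard tableau may have an edgeless graph, e.g. four single boxes per label, so no uniform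
`C` can serve there; the statement is typed from `n = 4` on, where the printed `2 × 2` grid
starts.) Companion of
`BDI2020_prop_7_5_upper` (clause (1), same file `BDI20HwvEvaluationHardness.lean`).
[cite: BlaserDorflerIkenmeyer2020, Prop 20 (2) (arXiv; = CCC 2021 Prop 7.5 (2))] locator:
paper:arxiv-2002.11594 p0016.txt:L24-25; CCC p.29:21 "▶ Proposition 7.5." -/
def BDI2020_prop_7_5_lower : Prop :=
  ∃ C : ℕ, ∀ n : ℕ, 4 ≤ n → ∃ S : List (List ℕ), IsTableauOfContent S n 4 ∧ IsSemistandard S ∧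
    (∀ c ∈ S, c.length ≤ 2) ∧ Nat.sqrt n ≤ C * treewidth (tableauGraph S n)

end Statement

end Literature.Computability.AlgebraicComplexity

end
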